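import Mathlib.Analysis.SpecialFunctions.Integrals.Basic
import Mathlib.Analysis.MeanInequalities
import Mathlib.Analysis.SpecialFunctions.Trigonometric.Bounds
import Mathlib.Analysis.Real.Pi.Bounds
import Literature.Computability.AlgebraicComplexity.IP17KroneckerPositivity
import Literature.Computability.AlgebraicComplexity.OddDistinctPartsTable
import Literature.Computability.AlgebraicComplexity.IP17HookRectangleKronecker
import HarnessLib

/-!
# Strict unimodality of `∏_{i=1}^m (1 + q^{2i-1})` (Pak–Panova 2014, Thm. 5.2 = Ikenmeyer–Panova 2017, Prop. 6.8) — PROVED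

Topic `Literature/Computability/AlgebraicComplexity`; a THEOREM file discharging the named fact
`ikenmeyerPanova2017_prop_6_8` of `IP17KroneckerPositivity.lean` (val-lit row IP2017-B):

> Pak–Panova 2014, Thm. 5.2. Let `𝒜_m(q) = ∏_{i=1}^m (1 + q^{2i-1}) = ∑_{n=0}^{m²} a_n q^n`. Then, for all
> `m ≥ 27`, the sequence `(a_{26}, …, a_{m²-26})` is symmetric and strictly unimodal.

(= Ikenmeyer–Panova 2017, Prop. 6.8 with `b_j = a_j = oddPartsSubsetCount 1 m j`, the number of
partitions of `j` into distinct odd parts `≤ 2m - 1`.) Main results: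
`ikenmeyerPanova2017_prop_6_8_holds : ikenmeyerPanova2017_prop_6_8` and the increasing half
`OddDistinctUnimodal.oddPartsSubsetCount_one_strictIncr` (`a_n(m) < a_{n+1}(m)` for `m ≥ 27`, `26 ≤ n`,
`2n + 2 ≤ m²`); §7: the monotonicity clause of Ikenmeyer–Panova's Thm. 6.1 unconditional
(`IkenmeyerPanova2017.thm_6_1_mono`). No new definitions of mathematical content (four plumbing defs: the trigonometric
product `cosProd`, the weight `oddSum`, the variance `oddSqSum`, the `integrand`), no facts.

## The printed proof and the tree's proof

Pak–Panova (arXiv:1304.5044 p. 8): "It suffices to show that `a_n < a_{n+1}` for all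
`26 ≤ n < (m²-1)/2`. … First, for `n ≥ 2m+1`, this was shown in [A1]" (Almkvist, *Partitions into odd,
unequal parts*, J. Pure Appl. Algebra 38 (1985) 121–126: an analytic proof "modeled on the
Odlyzko–Richmond proof", loc. cit. §7.3) "… for `n ≤ 2m` we have `a_n = q(n)`" and an explicit injection
`φ : 𝒬_n → 𝒬_{n+1}` gives `q(n) < q(n+1)` for `n ≥ 26`; `a_{2m+1} > a_{2m}` separately.

Almkvist's paper is not held (acquisition request acq-11678). The tree's proof replaces the appeal to
[A1] by a self-contained argument with the same analytic core (Odlyzko–Richmond's trigonometric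
integral), organised so that the analysis is only needed just below the middle coefficient:

1. **Recurrence and induction on `m`** (`OddDistinctTable.oddPartsSubsetCount_one_succ_right`:
   `a_s(m+1) = a_s(m) + a_{s-2m-1}(m)`, i.e. `𝒜_{m+1} = 𝒜_m (1 + q^{2m+1})`). If the strict increase holds
   at level `m` below the middle `m²/2`, it propagates to level `m+1` for all `n` with `2n + 2 ≤ m²`:
   the shifted term `a_{n+1-2m-1}(m) - a_{n-2m-1}(m)` is `≥ 0` except at `n = 2m+2` (`q(2) - q(1) = -1`),
   where `a_{2m+3}(m) - a_{2m+2}(m) ≥ 3` is obtained by unrolling the recurrence five more times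
   (`delta_special`; the small values `q(j)`, `j ≤ 26`, come from the certified table
   `OddDistinctTable.coeffs_thirteen_prefix` and the stability `a_j(m) = q(j)` for `j ≤ 2m`). Only the
   WINDOW `m² < 2n + 2 ≤ (m+1)²` (the `m + O(1)` coefficients just below the new middle) needs new
   input. (The same induction structure appears in Dong–Ji, arXiv:2306.04438, Thm. 1.2, for
   `k`-regular partitions, `k ≥ 5`.)
2. **The window by a trigonometric integral** (`window`, `M ≥ 100`): with
   `P_M(θ) = ∏_{j=1}^M cos((2j-1)θ)` one has `2^M P_M(θ) = ∑_{S ⊆ [1,M]} cos((M² - 2σ(S))θ)`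
   (`two_pow_mul_cosProd`), hence by orthogonality and the symmetry `a_n = a_{M²-n}` the coefficient
   formula `π a_n = 2^M ∫_0^π P_M(θ) cos((M²-2n)θ) dθ` and the difference formula
   `π (a_{n+1} - a_n) = 2^{M+1} ∫_0^π sin θ sin(νθ) P_M(θ) dθ = 2^{M+2} ∫_0^{π/2} (…)`, `ν = M² - 2n - 1`
   (`pi_mul_sub_eq`, folding by `P_M(π-θ) = (-1)^M P_M(θ)`). For `1 ≤ ν ≤ 2M`:
   * main term on `[0, b]`, `b = L^{-1/2}`, `L = 1/6 + ν²/6 + S_M/2`, `S_M = ∑(2j-1)² = (4M³-M)/3`: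
     `sin x ≥ x - x³/6`, `cos x ≥ 1 - x²/2` and the Weierstrass product inequality give
     `f(θ) ≥ ν θ²(1 - L θ²)`, so `∫_0^b f ≥ (2/15) ν L^{-3/2}`;
   * on `[b, π/(4M)]` the integrand is `≥ 0` (all arguments in `[0, π/2]`);
   * minor arc `(π/(4M), π/2]`: `P_M(θ)² ≤ ((1/M)∑_j cos²((2j-1)θ))^M` (AM–GM) and
     `∑_j cos²((2j-1)θ) = M/2 + sin(4Mθ)/(4 sin 2θ)` give `P_M(θ)² ≤ (5/8)^M` (`cosProd_sq_le`);
   * numerics: `(5/8)^M L³ ≤ (5/8)^M M⁹ ≤ 1/150` for `M ≥ 100`, and `π² < 9.93`, whence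
     `(π/2)(5/8)^{M/2} < (2/15) ν L^{-3/2}` and the half integral is positive.
3. **Base range `27 ≤ m ≤ 120`** by the kernel certificate
   `OddDistinctTable.oddPartsSubsetCount_strictIncr_base` (one `decide +kernel` sweep).

The constant `26`/`27` is the printed one (`q(25) = q(26) = 12`, Pak–Panova Rem. 5.3); the statement
proved is exactly the tree's `ikenmeyerPanova2017_prop_6_8` (nothing weakened).

HONEST FRAMING: an elementary theorem about partitions into distinct odd parts (the combinatorial input
of Ikenmeyer–Panova's Thm. 6.1 monotonicity clause via `ikenmeyerPanova2017_thm_6_1_mono`); nothing here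
is progress on permanent versus determinant; VP ≠ VNP is not proved.

## References

* I. Pak, G. Panova, *Unimodality via Kronecker products*, J. Algebraic Combin. 40 (2014) 1103–1120 =
  arXiv:1304.5044, Thm. 5.2, Rem. 5.3, §7.3 (held: paper:arxiv-1304.5044 p. 8, p. 10).
  [PakPanova2014Unimodality]
* C. Ikenmeyer, G. Panova, *Rectangular Kronecker coefficients and plethysms in geometric complexity
  theory*, Adv. Math. 319 (2017) 40–66 = arXiv:1512.03798, Prop. 6.8 (TeX L1430–1437).
  [IkenmeyerPanova2017]
* G. Almkvist, *Partitions into odd, unequal parts*, J. Pure Appl. Algebra 38 (1985) 121–126 (the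
  printed source of the case `n ≥ 2m+1`; not held, acq-11678; not used).
* A. M. Odlyzko, L. B. Richmond, *On the unimodality of some partition polynomials*, European J.
  Combin. 3 (1982) 69–84 (the trigonometric-integral method); J. Dong, K. Ji, arXiv:2306.04438
  (induction on the number of factors plus an estimate near the middle, for `k`-regular partitions).

## Mathlib

`Real.geom_mean_le_arith_mean` (AM–GM), `Real.sin_ge_sub_cube`, `Real.one_sub_sq_div_two_le_cos`,
`Real.pi_gt_d2`, `Real.pi_lt_d2`, `intervalIntegral.integral_eq_sub_of_hasDerivAt`, `integral_pow`,
`intervalIntegral.integral_comp_sub_left`, `intervalIntegral.norm_integral_le_of_norm_le_const`,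
`intervalIntegral.integral_mono_on`, `Real.sin_nat_mul_pi_sub`, `Real.cos_nat_mul_pi_sub`,
`Finset.powerset_insert`, `Nat.le_induction`.
Tree: `oddPartsSubsetCount`, `oddPartsSubsetCount_symm` (`IP17KroneckerPositivity`, t05 g0);
`OddDistinctTable.oddPartsSubsetCount_one_succ_right`, `…_strictIncr_base`, `…_thirteen_values`
(`OddDistinctPartsTable`, t05 g5).

Provenance: val-lit cell, seat t05 g5 (discharge of `ikenmeyerPanova2017_prop_6_8`, registry claim #1).
-/

open Real MeasureTheory intervalIntegral Finset

namespace Literature.Computability.AlgebraicComplexity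

namespace OddDistinctUnimodal

/-! ### §1 The trigonometric product and its Fourier expansion -/

/-- `P_M(θ) = ∏_{j=1}^{M} cos((2j-1)θ)` — the modulus part of Pak–Panova's `𝒜_M(e^{2iθ}) = 2^M e^{iM²θ} P_M(θ)` (Odlyzko–Richmond's trigonometric form of the generating product). Plumbing def. [cite: PakPanova2014Unimodality, Thm. 5.2 (held arXiv:1304.5044 p. 8)] -/
noncomputable def cosProd (M : ℕ) (θ : ℝ) : ℝ :=
  ∏ j ∈ Finset.Icc 1 M, Real.cos ((2 * (j : ℝ) - 1) * θ)

/-- `σ(S) = ∑_{i ∈ S} (2i - 1)`, the sum of the odd parts indexed by `S` (the weight in `oddPartsSubsetCount`). Plumbing def. [cite: IkenmeyerPanova2017, Prop. 6.8 (TeX L1430–1437; held: Proposition 32, chunk p0016)] -/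
def oddSum (S : Finset ℕ) : ℕ := ∑ i ∈ S, (2 * i - 1)

/-- `S_M = ∑_{j=1}^M (2j-1)²` (as a real number), the variance parameter of the main term. Plumbing def. [cite: PakPanova2014Unimodality, Thm. 5.2 (proof; held arXiv:1304.5044 p. 8)] -/
noncomputable def oddSqSum (M : ℕ) : ℝ := ∑ j ∈ Finset.Icc 1 M, (2 * (j : ℝ) - 1) ^ 2

/-- `[1, M+1] = [1, M] ∪ {M+1}`. [folklore] -/
private theorem Icc_succ (M : ℕ) : Finset.Icc 1 (M + 1) = insert (M + 1) (Finset.Icc 1 M) := by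
  ext i
  simp only [Finset.mem_insert, Finset.mem_Icc]
  omega

/-- `M + 1 ∉ [1, M]`. [folklore] -/
private theorem not_mem_Icc (M : ℕ) : M + 1 ∉ Finset.Icc 1 M := by simp

/-- Bridge to the tree's counting function (definitional). [folklore] -/
private theorem card_filter_oddSum (M k : ℕ) :
    ((Finset.Icc 1 M).powerset.filter fun S => oddSum S = k).card = oddPartsSubsetCount 1 M k := by
  rfl

/-- `∑_{i=1}^M (2i-1) = M²` (the degree of `∏_{i=1}^M (1+q^{2i-1})`). [cite: IkenmeyerPanova2017, Prop. 6.8 (TeX L1430–1437; held: Proposition 32, chunk p0016)] -/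
theorem sum_Icc_odd (M : ℕ) : ∑ i ∈ Finset.Icc 1 M, (2 * i - 1) = M ^ 2 := by
  induction M with
  | zero => rfl
  | succ M ih =>
    rw [Icc_succ, Finset.sum_insert (not_mem_Icc M), ih]
    ring_nf
    omega

/-- `∑_{j=1}^M (2j-1)² = (4M³ - M)/3`. [folklore] -/
private theorem oddSqSum_eq (M : ℕ) : oddSqSum M = (4 * (M : ℝ) ^ 3 - M) / 3 := by
  induction M with
  | zero => simp [oddSqSum]
  | succ M ih =>
    unfold oddSqSum at *
    rw [Icc_succ, Finset.sum_insert (not_mem_Icc M), ih]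
    push_cast
    ring

/-- `0 ≤ S_M`. [folklore] -/
private theorem oddSqSum_nonneg (M : ℕ) : 0 ≤ oddSqSum M :=
  Finset.sum_nonneg fun _ _ => sq_nonneg _

/-- A single term is at most the sum. [folklore] -/
private theorem sq_le_oddSqSum {M j : ℕ} (hj : j ∈ Finset.Icc 1 M) :
    (2 * (j : ℝ) - 1) ^ 2 ≤ oddSqSum M :=
  Finset.single_le_sum (f := fun j : ℕ => (2 * (j : ℝ) - 1) ^ 2) (fun _ _ => sq_nonneg _) hj

/-- `σ(S) ≤ M²` for `S ⊆ [1, M]`. [folklore] -/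
private theorem oddSum_le {M : ℕ} {S : Finset ℕ} (hS : S ∈ (Finset.Icc 1 M).powerset) : oddSum S ≤ M ^ 2 := by
  rw [← sum_Icc_odd]
  exact Finset.sum_le_sum_of_subset (Finset.mem_powerset.mp hS)

/-- `σ(S ∪ {M+1}) = 2M + 1 + σ(S)`. [folklore] -/
private theorem oddSum_insert {M : ℕ} {S : Finset ℕ} (hS : S ∈ (Finset.Icc 1 M).powerset) :
    oddSum (insert (M + 1) S) = 2 * M + 1 + oddSum S := by
  unfold oddSum
  rw [Finset.sum_insert (fun h => not_mem_Icc M (Finset.mem_powerset.mp hS h))]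
  omega

/-- Empty product. [folklore] -/
private theorem cosProd_zero (θ : ℝ) : cosProd 0 θ = 1 := by
  simp [cosProd]

/-- `P_{M+1}(θ) = cos((2M+1)θ) P_M(θ)`. [folklore] -/
private theorem cosProd_succ (M : ℕ) (θ : ℝ) :
    cosProd (M + 1) θ = Real.cos ((2 * (M : ℝ) + 1) * θ) * cosProd M θ := by
  unfold cosProd
  rw [Icc_succ, Finset.prod_insert (not_mem_Icc M)]
  push_cast
  ring_nf

/-- Continuity of `P_M`. [folklore] -/
private theorem continuous_cosProd (M : ℕ) : Continuous (cosProd M) := by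
  unfold cosProd
  exact continuous_finsetProd _ fun j _ => Real.continuous_cos.comp (continuous_const.mul continuous_id)

/-- **Fourier expansion of the product**: `2^M ∏_{j=1}^M cos((2j-1)θ) = ∑_{S ⊆ [1,M]} cos((M² - 2σ(S))θ)` (expand `∏ (e^{ix_j} + e^{-ix_j})`; real form via `2 cos a cos b = cos(a+b) + cos(a-b)`, induction on `M`). This is the identity behind `a_n = ` Fourier coefficient of `𝒜_M(e^{2iθ})` in the Odlyzko–Richmond/Almkvist method. [cite: PakPanova2014Unimodality, Thm. 5.2 (proof; held arXiv:1304.5044 p. 8)] -/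
theorem two_pow_mul_cosProd (M : ℕ) (θ : ℝ) :
    (2 : ℝ) ^ M * cosProd M θ =
      ∑ S ∈ (Finset.Icc 1 M).powerset, Real.cos (((M : ℝ) ^ 2 - 2 * (oddSum S : ℝ)) * θ) := by
  induction M with
  | zero => simp [cosProd, oddSum]
  | succ M ih =>
    have hdisj : Disjoint (Finset.Icc 1 M).powerset
        ((Finset.Icc 1 M).powerset.image (insert (M + 1))) := by
      rw [Finset.disjoint_left]
      intro S hS hS'
      obtain ⟨S', -, rfl⟩ := Finset.mem_image.mp hS'
      exact not_mem_Icc M (Finset.mem_powerset.mp hS (Finset.mem_insert_self _ _))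
    have hinj : Set.InjOn (insert (M + 1)) ((Finset.Icc 1 M).powerset : Set (Finset ℕ)) := by
      intro S₁ hS₁ S₂ hS₂ h
      have e₁ := Finset.erase_insert (fun h => not_mem_Icc M (Finset.mem_powerset.mp hS₁ h))
      have e₂ := Finset.erase_insert (fun h => not_mem_Icc M (Finset.mem_powerset.mp hS₂ h))
      rw [← e₁, ← e₂, h]
    rw [pow_succ, cosProd_succ, Icc_succ, Finset.powerset_insert, Finset.sum_union hdisj,
      Finset.sum_image hinj]
    have step : ∀ S ∈ (Finset.Icc 1 M).powerset,
        2 * Real.cos ((2 * (M : ℝ) + 1) * θ) * Real.cos (((M : ℝ) ^ 2 - 2 * (oddSum S : ℝ)) * θ) =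
          Real.cos ((((M + 1 : ℕ) : ℝ) ^ 2 - 2 * (oddSum S : ℝ)) * θ) +
            Real.cos ((((M + 1 : ℕ) : ℝ) ^ 2 - 2 * (oddSum (insert (M + 1) S) : ℝ)) * θ) := by
      intro S hS
      rw [oddSum_insert hS]
      push_cast
      have e1 : (((M : ℝ) + 1) ^ 2 - 2 * (oddSum S : ℝ)) * θ =
          ((M : ℝ) ^ 2 - 2 * (oddSum S : ℝ)) * θ + (2 * (M : ℝ) + 1) * θ := by ring
      have e2 : (((M : ℝ) + 1) ^ 2 - 2 * (2 * (M : ℝ) + 1 + (oddSum S : ℝ))) * θ =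
          ((M : ℝ) ^ 2 - 2 * (oddSum S : ℝ)) * θ - (2 * (M : ℝ) + 1) * θ := by ring
      rw [e1, e2, Real.cos_add, Real.cos_sub]
      ring
    calc (2 : ℝ) ^ M * 2 * (Real.cos ((2 * (M : ℝ) + 1) * θ) * cosProd M θ)
        = 2 * Real.cos ((2 * (M : ℝ) + 1) * θ) * ((2 : ℝ) ^ M * cosProd M θ) := by ring
      _ = ∑ S ∈ (Finset.Icc 1 M).powerset, 2 * Real.cos ((2 * (M : ℝ) + 1) * θ) *
            Real.cos (((M : ℝ) ^ 2 - 2 * (oddSum S : ℝ)) * θ) := by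
          rw [ih, Finset.mul_sum]
      _ = ∑ S ∈ (Finset.Icc 1 M).powerset,
            (Real.cos ((((M + 1 : ℕ) : ℝ) ^ 2 - 2 * (oddSum S : ℝ)) * θ) +
              Real.cos ((((M + 1 : ℕ) : ℝ) ^ 2 - 2 * (oddSum (insert (M + 1) S) : ℝ)) * θ)) :=
          Finset.sum_congr rfl step
      _ = _ := Finset.sum_add_distrib

/-! ### §2 Orthogonality and the coefficient formula -/

/-- `∫_0^π cos(αθ) dθ = sin(απ)/α` (`α ≠ 0`). [folklore] -/
private theorem integral_cos_mul_of_ne_zero {α : ℝ} (hα : α ≠ 0) :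
    ∫ θ in (0 : ℝ)..π, Real.cos (α * θ) = Real.sin (α * π) / α := by
  have hd : ∀ x ∈ Set.uIcc (0 : ℝ) π,
      HasDerivAt (fun θ => Real.sin (α * θ) / α) (Real.cos (α * x)) x := by
    intro x _
    have h := (((hasDerivAt_id' x).const_mul α).sin).div_const α
    exact h.congr_deriv (by field_simp)
  rw [intervalIntegral.integral_eq_sub_of_hasDerivAt hd
    ((Real.continuous_cos.comp (continuous_const.mul continuous_id)).intervalIntegrable _ _)]
  simp

/-- `∫_0^π cos(kθ) dθ = π [k = 0]` for an integer `k`. [folklore] -/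
private theorem integral_cos_int_mul (k : ℤ) :
    ∫ θ in (0 : ℝ)..π, Real.cos ((k : ℝ) * θ) = if k = 0 then π else 0 := by
  split_ifs with hk
  · subst hk
    simp
  · rw [integral_cos_mul_of_ne_zero (by exact_mod_cast hk), Real.sin_int_mul_pi, zero_div]

/-- Orthogonality `∫_0^π cos(xθ)cos(yθ) dθ` when `x ± y` are integers. [folklore] -/
private theorem integral_cos_mul_cos {x y : ℝ} {p q : ℤ} (hp : x - y = p) (hq : x + y = q) :
    ∫ θ in (0 : ℝ)..π, Real.cos (x * θ) * Real.cos (y * θ) =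
      ((if p = 0 then π else 0) + (if q = 0 then π else 0)) / 2 := by
  have h : ∀ θ : ℝ, Real.cos (x * θ) * Real.cos (y * θ) =
      (Real.cos ((p : ℝ) * θ) + Real.cos ((q : ℝ) * θ)) / 2 := by
    intro θ
    rw [← hp, ← hq, sub_mul, add_mul, Real.cos_sub, Real.cos_add]
    ring
  simp_rw [h]
  rw [intervalIntegral.integral_div, intervalIntegral.integral_add, integral_cos_int_mul,
    integral_cos_int_mul]
  · exact (Real.continuous_cos.comp (continuous_const.mul continuous_id)).intervalIntegrable _ _
  · exact (Real.continuous_cos.comp (continuous_const.mul continuous_id)).intervalIntegrable _ _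

/-- **Symmetry `a_n(M) = a_{M²-n}(M)`** (complementation `S ↦ [1,M] ∖ S`; the tree's `oddPartsSubsetCount_symm` with `∑_{i=1}^M (2i-1) = M²`): the clause "symmetric" of Ikenmeyer–Panova's Prop. 6.8 / Pak–Panova's Thm. 5.2 ("The symmetry is clear"). [cite: IkenmeyerPanova2017, Prop. 6.8 (TeX L1430–1437; held: Proposition 32, chunk p0016)] -/
theorem oddPartsSubsetCount_one_symm {M n : ℕ} (hn : n ≤ M ^ 2) :
    oddPartsSubsetCount 1 M n = oddPartsSubsetCount 1 M (M ^ 2 - n) := by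
  have h := oddPartsSubsetCount_symm 1 M n (by rw [sum_Icc_odd]; exact hn)
  rwa [sum_Icc_odd] at h

/-- **Coefficient formula**: `∫_0^π 2^M P_M(θ) cos((M²-2n)θ) dθ = π · a_n(M)` for `n ≤ M²` (orthogonality of cosines on `[0, π]` plus the symmetry `a_n = a_{M²-n}`): `a_n(M) = oddPartsSubsetCount 1 M n` is the `n`-th coefficient of `𝒜_M(q)`. [cite: PakPanova2014Unimodality, Thm. 5.2 (proof; held arXiv:1304.5044 p. 8)] -/
theorem integral_two_pow_cosProd_mul_cos {M n : ℕ} (hn : n ≤ M ^ 2) :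
    ∫ θ in (0 : ℝ)..π, (2 : ℝ) ^ M * cosProd M θ * Real.cos (((M : ℝ) ^ 2 - 2 * (n : ℝ)) * θ) =
      π * (oddPartsSubsetCount 1 M n : ℝ) := by
  have hcont : ∀ S : Finset ℕ, Continuous fun θ : ℝ =>
      Real.cos (((M : ℝ) ^ 2 - 2 * (oddSum S : ℝ)) * θ) * Real.cos (((M : ℝ) ^ 2 - 2 * (n : ℝ)) * θ) :=
    fun S => (Real.continuous_cos.comp (continuous_const.mul continuous_id)).mul
      (Real.continuous_cos.comp (continuous_const.mul continuous_id))
  simp_rw [two_pow_mul_cosProd, Finset.sum_mul]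
  rw [intervalIntegral.integral_finsetSum fun S _ => (hcont S).intervalIntegrable _ _]
  have hS : ∀ S ∈ (Finset.Icc 1 M).powerset,
      ∫ θ in (0 : ℝ)..π, Real.cos (((M : ℝ) ^ 2 - 2 * (oddSum S : ℝ)) * θ) *
          Real.cos (((M : ℝ) ^ 2 - 2 * (n : ℝ)) * θ) =
        (if oddSum S = n then π / 2 else 0) + (if oddSum S = M ^ 2 - n then π / 2 else 0) := by
    intro S hS
    have hle := oddSum_le hS
    rw [integral_cos_mul_cos (p := 2 * ((n : ℤ) - oddSum S)) (q := 2 * ((M : ℤ) ^ 2 - oddSum S - n))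
      (by push_cast; ring) (by push_cast; ring)]
    have e1 : (2 * ((n : ℤ) - oddSum S) = 0) ↔ oddSum S = n := by omega
    have e2 : (2 * ((M : ℤ) ^ 2 - oddSum S - n) = 0) ↔ oddSum S = M ^ 2 - n := by
      constructor
      · intro h
        zify [hle, hn]
        linarith
      · intro h
        zify [hle, hn] at h
        linarith
    simp only [e1, e2]
    split_ifs <;> ring
  rw [Finset.sum_congr rfl hS, Finset.sum_add_distrib, Finset.sum_ite, Finset.sum_ite]
  simp only [Finset.sum_const, nsmul_eq_mul]
  rw [card_filter_oddSum, card_filter_oddSum, ← oddPartsSubsetCount_one_symm hn]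
  ring

/-! ### §3 The difference `a_{n+1} - a_n` as an integral of `sin θ · sin(νθ) · P_M(θ)` -/

/-- The integrand `f(θ) = sin θ · sin(νθ) · P_M(θ)` of the difference formula (`ν = M² - 2n - 1`). Plumbing def. [cite: PakPanova2014Unimodality, Thm. 5.2 (proof; held arXiv:1304.5044 p. 8)] -/
noncomputable def integrand (M ν : ℕ) (θ : ℝ) : ℝ :=
  Real.sin θ * Real.sin ((ν : ℝ) * θ) * cosProd M θ

/-- Continuity of the integrand. [folklore] -/
private theorem continuous_integrand (M ν : ℕ) : Continuous (integrand M ν) := by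
  unfold integrand
  exact (Real.continuous_sin.mul (Real.continuous_sin.comp (continuous_const.mul continuous_id))).mul
    (continuous_cosProd M)

/-- Interval integrability of the integrand. [folklore] -/
private theorem intervalIntegrable_integrand (M ν : ℕ) (a b : ℝ) :
    IntervalIntegrable (integrand M ν) volume a b :=
  (continuous_integrand M ν).intervalIntegrable a b

/-- **Difference formula**: `π (a_{n+1}(M) - a_n(M)) = 2^{M+1} ∫_0^π sin θ · sin(νθ) · P_M(θ) dθ` with `ν = M² - 2n - 1` (`2n + 2 ≤ M²`), from the coefficient formula and `cos(A - B) - cos(A + B) = 2 sin A sin B`. The discrete analogue of the derivative `∂/∂n` used by Odlyzko–Richmond and Almkvist. [cite: PakPanova2014Unimodality, Thm. 5.2 (proof; held arXiv:1304.5044 p. 8)] -/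
theorem pi_mul_sub_eq {M n ν : ℕ} (hn : 2 * n + 2 ≤ M ^ 2) (hν : ν = M ^ 2 - 2 * n - 1) :
    π * ((oddPartsSubsetCount 1 M (n + 1) : ℝ) - oddPartsSubsetCount 1 M n) =
      (2 : ℝ) ^ (M + 1) * ∫ θ in (0 : ℝ)..π, integrand M ν θ := by
  have h1 := integral_two_pow_cosProd_mul_cos (M := M) (n := n + 1) (by omega)
  have h0 := integral_two_pow_cosProd_mul_cos (M := M) (n := n) (by omega)
  have hνr : (ν : ℝ) = (M : ℝ) ^ 2 - 2 * n - 1 := by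
    rw [hν]
    have : 2 * n + 1 ≤ M ^ 2 := by omega
    push_cast [Nat.cast_sub this, Nat.sub_sub]
    ring
  have key : ∀ θ : ℝ, (2 : ℝ) ^ (M + 1) * integrand M ν θ =
      (2 : ℝ) ^ M * cosProd M θ * Real.cos (((M : ℝ) ^ 2 - 2 * ((n + 1 : ℕ) : ℝ)) * θ) -
        (2 : ℝ) ^ M * cosProd M θ * Real.cos (((M : ℝ) ^ 2 - 2 * (n : ℝ)) * θ) := by
    intro θ
    unfold integrand
    rw [hνr]
    push_cast
    have e1 : ((M : ℝ) ^ 2 - 2 * ((n : ℝ) + 1)) * θ = ((M : ℝ) ^ 2 - 2 * n - 1) * θ - θ := by ring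
    have e2 : ((M : ℝ) ^ 2 - 2 * (n : ℝ)) * θ = ((M : ℝ) ^ 2 - 2 * n - 1) * θ + θ := by ring
    rw [e1, e2, Real.cos_sub, Real.cos_add]
    ring
  rw [mul_sub, ← h1, ← h0, ← intervalIntegral.integral_const_mul,
    ← intervalIntegral.integral_sub]
  · exact intervalIntegral.integral_congr fun θ _ => (key θ).symm
  · exact (((continuous_const.mul (continuous_cosProd M)).mul
      (Real.continuous_cos.comp (continuous_const.mul continuous_id))).intervalIntegrable _ _)
  · exact (((continuous_const.mul (continuous_cosProd M)).mul
      (Real.continuous_cos.comp (continuous_const.mul continuous_id))).intervalIntegrable _ _)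

/-- `P_M(π - θ) = (-1)^M P_M(θ)`. [folklore] -/
private theorem cosProd_pi_sub (M : ℕ) (θ : ℝ) : cosProd M (π - θ) = (-1) ^ M * cosProd M θ := by
  unfold cosProd
  have h : ∀ j ∈ Finset.Icc 1 M,
      Real.cos ((2 * (j : ℝ) - 1) * (π - θ)) = -Real.cos ((2 * (j : ℝ) - 1) * θ) := by
    intro j hj
    have hj1 : 1 ≤ j := (Finset.mem_Icc.mp hj).1
    have e : (2 * (j : ℝ) - 1) * (π - θ) = ((2 * j - 1 : ℕ) : ℝ) * π - (2 * (j : ℝ) - 1) * θ := by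
      push_cast [Nat.cast_sub (by omega : 1 ≤ 2 * j)]
      ring
    rw [e, Real.cos_nat_mul_pi_sub]
    have hodd : Odd (2 * j - 1) := ⟨j - 1, by omega⟩
    rw [hodd.neg_one_pow]
    ring
  rw [Finset.prod_congr rfl h, Finset.prod_neg, Nat.card_Icc, Nat.add_sub_cancel]

/-- Symmetry of the integrand about `π/2` (parity `ν + M + 1` even). [folklore] -/
private theorem integrand_pi_sub {M ν : ℕ} (heven : Even (ν + M + 1)) (θ : ℝ) :
    integrand M ν (π - θ) = integrand M ν θ := by
  unfold integrand
  rw [Real.sin_pi_sub, mul_sub, Real.sin_nat_mul_pi_sub, cosProd_pi_sub]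
  have h1 : ((-1 : ℝ) ^ ν) * (-1) ^ M * (-1) = 1 := by
    rw [← pow_add, ← pow_succ, heven.neg_one_pow]
  calc Real.sin θ * -((-1) ^ ν * Real.sin ((ν : ℝ) * θ)) * ((-1) ^ M * cosProd M θ)
      = (((-1 : ℝ) ^ ν) * (-1) ^ M * (-1)) * (Real.sin θ * Real.sin ((ν : ℝ) * θ) * cosProd M θ) := by
        ring
    _ = _ := by rw [h1, one_mul]

/-- Folding: `∫_0^π f = 2 ∫_0^{π/2} f`. [folklore] -/
private theorem integral_eq_two_mul {M ν : ℕ} (heven : Even (ν + M + 1)) :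
    ∫ θ in (0 : ℝ)..π, integrand M ν θ = 2 * ∫ θ in (0 : ℝ)..(π / 2), integrand M ν θ := by
  have hsplit := intervalIntegral.integral_add_adjacent_intervals
    (intervalIntegrable_integrand M ν 0 (π / 2)) (intervalIntegrable_integrand M ν (π / 2) π)
  have hsub : ∫ θ in (0 : ℝ)..(π / 2), integrand M ν (π - θ) =
      ∫ θ in (π / 2 : ℝ)..π, integrand M ν θ := by
    rw [intervalIntegral.integral_comp_sub_left (fun θ => integrand M ν θ) π]
    congr 1 <;> ring
  rw [← hsplit, ← hsub]
  simp_rw [integrand_pi_sub heven]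
  ring

/-! ### §4 The estimates -/

/-- Weierstrass product inequality `1 - ∑ a_i ≤ ∏ (1 - a_i)` (`0 ≤ a_i ≤ 1`). [folklore] -/
private theorem one_sub_sum_le_prod {ι : Type*} (s : Finset ι) (a : ι → ℝ) (h0 : ∀ i ∈ s, 0 ≤ a i)
    (h1 : ∀ i ∈ s, a i ≤ 1) : 1 - ∑ i ∈ s, a i ≤ ∏ i ∈ s, (1 - a i) := by
  classical
  induction s using Finset.induction_on with
  | empty => simp
  | insert i s hi ih =>
    rw [Finset.sum_insert hi, Finset.prod_insert hi]
    have ha0 : 0 ≤ a i := h0 i (Finset.mem_insert_self _ _)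
    have ha1 : a i ≤ 1 := h1 i (Finset.mem_insert_self _ _)
    have hs0 : 0 ≤ ∑ j ∈ s, a j := Finset.sum_nonneg fun j hj => h0 j (Finset.mem_insert_of_mem hj)
    have ih' := ih (fun j hj => h0 j (Finset.mem_insert_of_mem hj))
      (fun j hj => h1 j (Finset.mem_insert_of_mem hj))
    nlinarith [mul_nonneg ha0 hs0, mul_le_mul_of_nonneg_left ih' (sub_nonneg.mpr ha1)]

/-- Lower bound of the product near `0`: `1 - S_M θ²/2 ≤ P_M(θ)` when `S_M θ² ≤ 2` (`cos x ≥ 1 - x²/2` and the Weierstrass inequality). [folklore] -/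
private theorem cosProd_ge {M : ℕ} {θ : ℝ} (hθ : oddSqSum M * θ ^ 2 ≤ 2) :
    1 - oddSqSum M * θ ^ 2 / 2 ≤ cosProd M θ := by
  unfold cosProd
  have hterm : ∀ j ∈ Finset.Icc 1 M, ((2 * (j : ℝ) - 1) * θ) ^ 2 / 2 ≤ 1 := by
    intro j hj
    have := sq_le_oddSqSum hj
    have h2 : ((2 * (j : ℝ) - 1) * θ) ^ 2 = (2 * (j : ℝ) - 1) ^ 2 * θ ^ 2 := by ring
    rw [h2]
    nlinarith [sq_nonneg θ]
  calc 1 - oddSqSum M * θ ^ 2 / 2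
      = 1 - ∑ j ∈ Finset.Icc 1 M, ((2 * (j : ℝ) - 1) * θ) ^ 2 / 2 := by
        unfold oddSqSum
        rw [Finset.sum_mul, Finset.sum_div]
        congr 1
        apply Finset.sum_congr rfl
        intro j _
        ring
    _ ≤ ∏ j ∈ Finset.Icc 1 M, (1 - ((2 * (j : ℝ) - 1) * θ) ^ 2 / 2) :=
        one_sub_sum_le_prod _ _ (fun j _ => by positivity) hterm
    _ ≤ ∏ j ∈ Finset.Icc 1 M, Real.cos ((2 * (j : ℝ) - 1) * θ) := by
        apply Finset.prod_le_prod
        · intro j hj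
          linarith [hterm j hj]
        · intro j _
          exact Real.one_sub_sq_div_two_le_cos

/-- `1 - a - b - c ≤ (1-a)(1-b)(1-c)` for `a, b ∈ [0,1]`, `c ≥ 0`. [folklore] -/
private theorem one_sub_three_le {a b c : ℝ} (ha0 : 0 ≤ a) (ha1 : a ≤ 1) (hb0 : 0 ≤ b) (hb1 : b ≤ 1)
    (hc0 : 0 ≤ c) : 1 - a - b - c ≤ (1 - a) * (1 - b) * (1 - c) := by
  have hab : 0 ≤ (1 - a) * (1 - b) := mul_nonneg (sub_nonneg.mpr ha1) (sub_nonneg.mpr hb1)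
  nlinarith [mul_nonneg ha0 hb0, mul_nonneg hab hc0, mul_nonneg ha0 hc0, mul_nonneg hb0 hc0,
    mul_nonneg (mul_nonneg ha0 hb0) hc0]

/-- Pointwise lower bound of the integrand on `[0, b]`: `ν θ² (1 - L θ²) ≤ f(θ)` with `L = 1/6 + ν²/6 + S_M/2` when `L θ² ≤ 1` (`sin x ≥ x - x³/6` twice and `cosProd_ge`). [folklore] -/
private theorem integrand_ge {M ν : ℕ} {θ : ℝ} (hθ0 : 0 ≤ θ)
    (hθ : (1 / 6 + (ν : ℝ) ^ 2 / 6 + oddSqSum M / 2) * θ ^ 2 ≤ 1) :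
    (ν : ℝ) * θ ^ 2 * (1 - (1 / 6 + (ν : ℝ) ^ 2 / 6 + oddSqSum M / 2) * θ ^ 2) ≤ integrand M ν θ := by
  have hS := oddSqSum_nonneg M
  have hν0 : (0 : ℝ) ≤ ν := Nat.cast_nonneg ν
  have hSθ : oddSqSum M * θ ^ 2 ≤ 2 := by nlinarith [sq_nonneg θ, sq_nonneg ((ν : ℝ) * θ)]
  have hθ2 : θ ^ 2 ≤ 6 := by nlinarith [sq_nonneg θ, sq_nonneg ((ν : ℝ) * θ)]
  have hνθ2 : ((ν : ℝ) * θ) ^ 2 ≤ 6 := by nlinarith [sq_nonneg θ, sq_nonneg ((ν : ℝ) * θ)]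
  -- the three lower bounds
  have l1 : θ - θ ^ 3 / 6 ≤ Real.sin θ := Real.sin_ge_sub_cube hθ0
  have l2 : (ν : ℝ) * θ - ((ν : ℝ) * θ) ^ 3 / 6 ≤ Real.sin ((ν : ℝ) * θ) :=
    Real.sin_ge_sub_cube (mul_nonneg hν0 hθ0)
  have l3 : 1 - oddSqSum M * θ ^ 2 / 2 ≤ cosProd M θ := cosProd_ge hSθ
  have p1 : 0 ≤ θ - θ ^ 3 / 6 := by nlinarith
  have p2 : 0 ≤ (ν : ℝ) * θ - ((ν : ℝ) * θ) ^ 3 / 6 := by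
    have : 0 ≤ (ν : ℝ) * θ := mul_nonneg hν0 hθ0
    nlinarith
  have p3 : 0 ≤ 1 - oddSqSum M * θ ^ 2 / 2 := by nlinarith
  have hprod : (θ - θ ^ 3 / 6) * ((ν : ℝ) * θ - ((ν : ℝ) * θ) ^ 3 / 6) * (1 - oddSqSum M * θ ^ 2 / 2) ≤
      integrand M ν θ := by
    unfold integrand
    have s1 : 0 ≤ Real.sin θ := le_trans p1 l1
    have s2 : 0 ≤ Real.sin ((ν : ℝ) * θ) := le_trans p2 l2
    calc (θ - θ ^ 3 / 6) * ((ν : ℝ) * θ - ((ν : ℝ) * θ) ^ 3 / 6) * (1 - oddSqSum M * θ ^ 2 / 2)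
        ≤ Real.sin θ * Real.sin ((ν : ℝ) * θ) * (1 - oddSqSum M * θ ^ 2 / 2) := by
          apply mul_le_mul_of_nonneg_right _ p3
          exact mul_le_mul l1 l2 p2 s1
      _ ≤ Real.sin θ * Real.sin ((ν : ℝ) * θ) * cosProd M θ :=
          mul_le_mul_of_nonneg_left l3 (mul_nonneg s1 s2)
  have hthree := one_sub_three_le (a := θ ^ 2 / 6) (b := ((ν : ℝ) * θ) ^ 2 / 6)
    (c := oddSqSum M * θ ^ 2 / 2) (by positivity) (by linarith) (by positivity) (by linarith)
    (by positivity)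
  calc (ν : ℝ) * θ ^ 2 * (1 - (1 / 6 + (ν : ℝ) ^ 2 / 6 + oddSqSum M / 2) * θ ^ 2)
      = (ν : ℝ) * θ ^ 2 * (1 - θ ^ 2 / 6 - ((ν : ℝ) * θ) ^ 2 / 6 - oddSqSum M * θ ^ 2 / 2) := by ring
    _ ≤ (ν : ℝ) * θ ^ 2 * ((1 - θ ^ 2 / 6) * (1 - ((ν : ℝ) * θ) ^ 2 / 6) * (1 - oddSqSum M * θ ^ 2 / 2)) :=
        mul_le_mul_of_nonneg_left hthree (by positivity)
    _ = (θ - θ ^ 3 / 6) * ((ν : ℝ) * θ - ((ν : ℝ) * θ) ^ 3 / 6) * (1 - oddSqSum M * θ ^ 2 / 2) := by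
        ring
    _ ≤ integrand M ν θ := hprod

/-- **Main term**: `∫_0^b f ≥ (2/15) ν b³` for `b = L^{-1/2}` (integrate the polynomial minorant). [folklore] -/
private theorem integral_main_ge {M ν : ℕ} {L b : ℝ} (hL : L = 1 / 6 + (ν : ℝ) ^ 2 / 6 + oddSqSum M / 2)
    (hb0 : 0 < b) (hbL : b ^ 2 * L = 1) :
    2 / 15 * (ν : ℝ) * b ^ 3 ≤ ∫ θ in (0 : ℝ)..b, integrand M ν θ := by
  have hLpos : 0 < L := by
    rw [hL]; have := oddSqSum_nonneg M; positivity
  have hpoly : ∫ θ in (0 : ℝ)..b, (ν : ℝ) * θ ^ 2 * (1 - L * θ ^ 2) = 2 / 15 * (ν : ℝ) * b ^ 3 := by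
    have e : ∀ θ : ℝ, (ν : ℝ) * θ ^ 2 * (1 - L * θ ^ 2) = (ν : ℝ) * θ ^ 2 - (ν : ℝ) * L * θ ^ 4 := by
      intro θ; ring
    simp_rw [e]
    rw [intervalIntegral.integral_sub, intervalIntegral.integral_const_mul,
      intervalIntegral.integral_const_mul, integral_pow, integral_pow]
    · push_cast
      linear_combination (-((ν : ℝ) * b ^ 3 / 5)) * hbL
    · exact (continuous_const.mul (continuous_pow 2)).intervalIntegrable _ _
    · exact (continuous_const.mul (continuous_pow 4)).intervalIntegrable _ _
  rw [← hpoly]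
  apply intervalIntegral.integral_mono_on hb0.le
    ((by fun_prop : Continuous fun θ : ℝ => (ν : ℝ) * θ ^ 2 * (1 - L * θ ^ 2)).intervalIntegrable 0 b)
    (intervalIntegrable_integrand M ν 0 b)
  intro θ hθ
  have hθ0 : 0 ≤ θ := hθ.1
  have hθb : θ ≤ b := hθ.2
  have hθL : L * θ ^ 2 ≤ 1 := by
    have : θ ^ 2 ≤ b ^ 2 := pow_le_pow_left₀ hθ0 hθb 2
    nlinarith
  rw [hL] at hθL ⊢
  exact integrand_ge hθ0 hθL

/-- Nonnegativity of the integrand on `[0, π/(4M)]` when `ν ≤ 2M` (all factors nonnegative). [folklore] -/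
private theorem integrand_nonneg {M ν : ℕ} (hM : 1 ≤ M) (hν : ν ≤ 2 * M) {θ : ℝ} (hθ0 : 0 ≤ θ)
    (hθ : θ ≤ π / (4 * M)) : 0 ≤ integrand M ν θ := by
  have hMr : (1 : ℝ) ≤ M := by exact_mod_cast hM
  have hMpos : (0 : ℝ) < M := by linarith
  have hθle : θ ≤ π / 4 := by
    calc θ ≤ π / (4 * M) := hθ
      _ ≤ π / 4 := by
        apply div_le_div_of_nonneg_left Real.pi_pos.le (by norm_num)
        nlinarith
  unfold integrand cosProd
  apply mul_nonneg (mul_nonneg _ _)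
  · apply Finset.prod_nonneg
    intro j hj
    have hj := Finset.mem_Icc.mp hj
    have hjr : (j : ℝ) ≤ M := by exact_mod_cast hj.2
    have hj1 : (1 : ℝ) ≤ j := by exact_mod_cast hj.1
    apply Real.cos_nonneg_of_mem_Icc
    constructor
    · have : 0 ≤ (2 * (j : ℝ) - 1) * θ := mul_nonneg (by linarith) hθ0
      linarith [Real.pi_pos]
    · calc (2 * (j : ℝ) - 1) * θ ≤ (2 * M - 1) * (π / (4 * M)) := by
            apply mul_le_mul (by linarith) hθ hθ0 (by linarith)
        _ = π / 2 - π / (4 * M) := by field_simp; ring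
        _ ≤ π / 2 := by linarith [div_pos Real.pi_pos (by positivity : (0:ℝ) < 4 * M)]
  · exact Real.sin_nonneg_of_nonneg_of_le_pi hθ0 (by linarith [Real.pi_pos])
  · apply Real.sin_nonneg_of_nonneg_of_le_pi (mul_nonneg (Nat.cast_nonneg ν) hθ0)
    have hνr : (ν : ℝ) ≤ 2 * M := by exact_mod_cast hν
    calc (ν : ℝ) * θ ≤ 2 * M * (π / (4 * M)) :=
          mul_le_mul hνr hθ hθ0 (by positivity)
      _ = π / 2 := by field_simp; ring
      _ ≤ π := by linarith [Real.pi_pos]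

/-! #### The minor arc: `P_M(θ)² ≤ (5/8)^M` on `(π/(4M), π/2]` -/

/-- `∑_{j=1}^M cos²((2j-1)θ) = M/2 + sin(4Mθ)/(4 sin 2θ)` (`sin 2θ ≠ 0`). [folklore] -/
private theorem sum_cos_sq (M : ℕ) {θ : ℝ} (hs : Real.sin (2 * θ) ≠ 0) :
    ∑ j ∈ Finset.Icc 1 M, Real.cos ((2 * (j : ℝ) - 1) * θ) ^ 2 =
      (M : ℝ) / 2 + Real.sin (4 * M * θ) / (4 * Real.sin (2 * θ)) := by
  induction M with
  | zero => simp
  | succ M ih =>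
    rw [Icc_succ, Finset.sum_insert (not_mem_Icc M), ih, Real.cos_sq]
    push_cast
    have key : Real.sin (4 * ((M : ℝ) + 1) * θ) =
        Real.sin (4 * M * θ) + 2 * Real.cos (2 * ((2 * ((M : ℝ) + 1) - 1) * θ)) * Real.sin (2 * θ) := by
      have e1 : 4 * ((M : ℝ) + 1) * θ = (4 * M + 2) * θ + 2 * θ := by ring
      have e2 : 4 * (M : ℝ) * θ = (4 * M + 2) * θ - 2 * θ := by ring
      have e3 : 2 * ((2 * ((M : ℝ) + 1) - 1) * θ) = (4 * M + 2) * θ := by ring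
      rw [e1, e2, e3, Real.sin_add, Real.sin_sub]
      ring
    rw [key]
    field_simp
    ring

/-- AM–GM: `P_M(θ)² ≤ ((∑_j cos²((2j-1)θ))/M)^M`. [folklore] -/
private theorem cosProd_sq_le_mean_pow {M : ℕ} (hM : 1 ≤ M) (θ : ℝ) :
    cosProd M θ ^ 2 ≤ ((∑ j ∈ Finset.Icc 1 M, Real.cos ((2 * (j : ℝ) - 1) * θ) ^ 2) / M) ^ M := by
  set z : ℕ → ℝ := fun j => Real.cos ((2 * (j : ℝ) - 1) * θ) ^ 2 with hz
  have hz0 : ∀ j ∈ Finset.Icc 1 M, 0 ≤ z j := fun j _ => sq_nonneg _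
  have hcard : (Finset.Icc 1 M).card = M := by simp
  have hsumw : ∑ j ∈ Finset.Icc 1 M, (fun _ : ℕ => (1 : ℝ)) j = M := by simp
  have hMpos : (0 : ℝ) < M := by exact_mod_cast hM
  have amgm := Real.geom_mean_le_arith_mean (Finset.Icc 1 M) (fun _ => (1 : ℝ)) z
    (fun _ _ => zero_le_one) (by rw [hsumw]; exact hMpos) hz0
  rw [hsumw] at amgm
  simp only [Real.rpow_one, one_mul] at amgm
  -- amgm : (∏ z j) ^ (M:ℝ)⁻¹ ≤ (∑ z j) / M
  have hG0 : 0 ≤ ∏ j ∈ Finset.Icc 1 M, z j := Finset.prod_nonneg hz0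
  have hA0 : 0 ≤ (∏ j ∈ Finset.Icc 1 M, z j) ^ ((M : ℝ)⁻¹) := Real.rpow_nonneg hG0 _
  have hpow := pow_le_pow_left₀ hA0 amgm M
  rw [← Real.rpow_natCast, ← Real.rpow_mul hG0, inv_mul_cancel₀ hMpos.ne', Real.rpow_one] at hpow
  have hsq : cosProd M θ ^ 2 = ∏ j ∈ Finset.Icc 1 M, z j := by
    unfold cosProd
    rw [← Finset.prod_pow]
  rw [hsq]
  exact hpow

/-- The mean `1/2 + sin(4Mθ)/(4M sin 2θ)` is at most `5/8` on `(π/(4M), π/2)` for `M ≥ 10` (four ranges of `θ`: sign of `sin 4Mθ` near the ends, `sin 2θ ≥ sin(π/M) ≥ 3/M` in the bulk, and `sin φ ≤ min(φ,1)` with `sin x ≥ x - x³/6` in the remaining range). [folklore] -/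
private theorem mean_le {M : ℕ} (hM : 10 ≤ M) {θ : ℝ} (hθ1 : π / (4 * M) < θ) (hθ2 : θ < π / 2) :
    1 / 2 + Real.sin (4 * M * θ) / (4 * M * Real.sin (2 * θ)) ≤ 5 / 8 := by
  have hMr : (10 : ℝ) ≤ M := by exact_mod_cast hM
  have hMpos : (0 : ℝ) < M := by linarith
  have hπ := Real.pi_pos
  have hπ3 : 3.14 < π := Real.pi_gt_d2
  have hπ4 : π < 3.15 := Real.pi_lt_d2
  have hM2 : (100 : ℝ) ≤ (M : ℝ) ^ 2 := by nlinarith only [hMr]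
  have hθpos : 0 < θ := lt_trans (by positivity) hθ1
  have hs : 0 < Real.sin (2 * θ) := Real.sin_pos_of_pos_of_lt_pi (by linarith) (by linarith)
  have hden : 0 < 4 * M * Real.sin (2 * θ) := by positivity
  have hπM : π / M = 2 * (π / (2 * M)) := by field_simp
  -- it suffices to bound the ratio by 1/8
  suffices h : Real.sin (4 * M * θ) / (4 * M * Real.sin (2 * θ)) ≤ 1 / 8 by linarith
  rw [div_le_iff₀ hden]
  -- Case analysis on θ.
  by_cases hA : θ ≤ π / (2 * M)
  · -- (A): 4Mθ ∈ (π, 2π], sin(4Mθ) ≤ 0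
    have h1 : π < 4 * M * θ := by
      have := (div_lt_iff₀ (by positivity : (0 : ℝ) < 4 * M)).mp hθ1; linarith
    have h2 : 4 * M * θ ≤ 2 * π := by
      have := (le_div_iff₀ (by positivity : (0 : ℝ) < 2 * M)).mp hA; linarith
    have : Real.sin (4 * M * θ) ≤ 0 := by
      have e : Real.sin (4 * M * θ) = -Real.sin (4 * M * θ - π) := by
        rw [Real.sin_sub_pi]; ring
      rw [e, neg_nonpos]
      exact Real.sin_nonneg_of_nonneg_of_le_pi (by linarith) (by linarith)
    linarith
  push Not at hA
  by_cases hB : θ ≤ π / 2 - π / (2 * M)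
  · -- (B): sin 2θ ≥ sin(π/M) ≥ 3/M
    have hsin1 : Real.sin (4 * M * θ) ≤ 1 := Real.sin_le_one _
    have hpm : π / M - (π / M) ^ 3 / 6 ≤ Real.sin (π / M) := Real.sin_ge_sub_cube (by positivity)
    have hπcube : π ^ 3 < 32 := by
      have h := pow_lt_pow_left₀ hπ4 hπ.le three_ne_zero
      norm_num at h
      linarith
    have h3M : 3 / (M : ℝ) ≤ Real.sin (π / M) := by
      have hM3pos : 0 < (M : ℝ) ^ 3 := by positivity
      have hnum : 0 ≤ (π - 3) * (M : ℝ) ^ 2 - π ^ 3 / 6 := by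
        nlinarith only [mul_nonneg (sub_nonneg.mpr hπ3.le) (sq_nonneg (M : ℝ)), hM2, hπcube]
      have e : π / M - (π / M) ^ 3 / 6 - 3 / M = ((π - 3) * (M : ℝ) ^ 2 - π ^ 3 / 6) / (M : ℝ) ^ 3 := by
        field_simp
        ring
      have : 0 ≤ π / M - (π / M) ^ 3 / 6 - 3 / M := by rw [e]; exact div_nonneg hnum hM3pos.le
      linarith
    have hsin2 : Real.sin (π / M) ≤ Real.sin (2 * θ) := by
      by_cases h2θ : 2 * θ ≤ π / 2
      · apply Real.sin_le_sin_of_le_of_le_pi_div_two (by linarith [div_nonneg hπ.le hMpos.le]) h2θ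
        rw [hπM]; linarith
      · push Not at h2θ
        rw [show Real.sin (2 * θ) = Real.sin (π - 2 * θ) by rw [Real.sin_pi_sub]]
        apply Real.sin_le_sin_of_le_of_le_pi_div_two (by linarith [div_nonneg hπ.le hMpos.le])
          (by linarith)
        rw [hπM]; linarith
    have h3 : (3 : ℝ) ≤ M * Real.sin (2 * θ) := by
      have := le_trans h3M hsin2
      rw [div_le_iff₀ hMpos] at this; linarith
    linarith
  push Not at hB
  -- θ > π/2 - π/(2M): write δ = π/2 - θ ∈ (0, π/(2M))
  obtain ⟨δ, hδ⟩ : ∃ δ : ℝ, δ = π / 2 - θ := ⟨_, rfl⟩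
  have hδpos : 0 < δ := by rw [hδ]; linarith
  have hδlt : δ < π / (2 * M) := by rw [hδ]; linarith
  have hs2 : Real.sin (2 * θ) = Real.sin (2 * δ) := by
    rw [hδ, show 2 * (π / 2 - θ) = π - 2 * θ by ring, Real.sin_pi_sub]
  have hs4 : Real.sin (4 * M * θ) = -Real.sin (4 * M * δ) := by
    have e : 4 * (M : ℝ) * θ = ((2 * M : ℕ) : ℝ) * π - 4 * M * δ := by
      rw [hδ]; push_cast; ring
    rw [e, Real.sin_nat_mul_pi_sub, pow_mul]
    norm_num
  have hs2pos : 0 < Real.sin (2 * δ) := by rw [← hs2]; exact hs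
  have hden' : 0 < 4 * M * Real.sin (2 * δ) := by positivity
  rw [hs2, hs4]
  by_cases hD : δ ≤ π / (4 * M)
  · -- (D): 4Mδ ∈ (0, π], sin(4Mδ) ≥ 0
    have h4 : 4 * M * δ ≤ π := by
      have := (le_div_iff₀ (by positivity : (0 : ℝ) < 4 * M)).mp hD; linarith
    have : 0 ≤ Real.sin (4 * M * δ) :=
      Real.sin_nonneg_of_nonneg_of_le_pi (by positivity) h4
    linarith
  · -- (C): δ ∈ (π/(4M), π/(2M)); φ = 4Mδ - π ∈ (0, π)
    push Not at hD
    obtain ⟨φ, hφ⟩ : ∃ φ : ℝ, φ = 4 * M * δ - π := ⟨_, rfl⟩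
    have hφpos : 0 < φ := by
      have := (div_lt_iff₀ (by positivity : (0 : ℝ) < 4 * M)).mp hD
      rw [hφ]; linarith
    have hφlt : φ < π := by
      have := (lt_div_iff₀ (by positivity : (0 : ℝ) < 2 * M)).mp hδlt
      rw [hφ]; linarith
    have hsφ : -Real.sin (4 * M * δ) = Real.sin φ := by
      rw [hφ, Real.sin_sub_pi]
    rw [hsφ]
    have h2δ : 2 * δ = (π + φ) / (2 * M) := by
      rw [hφ]; field_simp; ring
    have hsin2δ : 2 * δ - (2 * δ) ^ 3 / 6 ≤ Real.sin (2 * δ) := Real.sin_ge_sub_cube (by linarith)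
    -- 4M sin(2δ) ≥ 2(π+φ) - (π+φ)³/(12 M²)
    have hlow : 2 * (π + φ) - (π + φ) ^ 3 / (12 * (M : ℝ) ^ 2) ≤ 4 * M * Real.sin (2 * δ) := by
      have e : 4 * (M : ℝ) * (2 * δ - (2 * δ) ^ 3 / 6) =
          2 * (π + φ) - (π + φ) ^ 3 / (12 * (M : ℝ) ^ 2) := by
        rw [h2δ]; field_simp; ring
      rw [← e]
      exact mul_le_mul_of_nonneg_left hsin2δ (by positivity)
    have hcube : (π + φ) ^ 3 ≤ 260 := by
      have h6 : π + φ < 6.3 := by linarith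
      have h := pow_lt_pow_left₀ h6 (by positivity) three_ne_zero
      norm_num at h
      linarith
    have hsmall : (π + φ) ^ 3 / (12 * (M : ℝ) ^ 2) ≤ 0.22 := by
      rw [div_le_iff₀ (by positivity)]
      nlinarith only [hcube, hM2]
    have hsinφ1 : Real.sin φ ≤ 1 := Real.sin_le_one φ
    have hsinφ2 : Real.sin φ ≤ φ := Real.sin_le hφpos.le
    by_cases hφ1 : φ ≤ 1
    · linarith
    · push Not at hφ1
      linarith

/-- **Minor-arc bound** (our replacement for the analytic estimates of [A1] = Almkvist 1985 in the proof of Pak–Panova's Thm. 5.2): `P_M(θ)² ≤ (5/8)^M` for `θ ∈ (π/(4M), π/2]`, `M ≥ 10`, by the arithmetic–geometric mean inequality applied to `cos²((2j-1)θ)` and the closed form of `∑_j cos²((2j-1)θ)`. [cite: PakPanova2014Unimodality, Thm. 5.2 (proof; held arXiv:1304.5044 p. 8)] -/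
theorem cosProd_sq_le {M : ℕ} (hM : 10 ≤ M) {θ : ℝ} (hθ1 : π / (4 * M) < θ) (hθ2 : θ ≤ π / 2) :
    cosProd M θ ^ 2 ≤ (5 / 8 : ℝ) ^ M := by
  have hM1 : 1 ≤ M := le_trans (by norm_num) hM
  have hMpos : (0 : ℝ) < M := by exact_mod_cast (lt_of_lt_of_le (by norm_num) hM : 0 < M)
  rcases eq_or_lt_of_le hθ2 with h | h
  · -- θ = π/2: the factor j = 1 vanishes
    have : cosProd M θ = 0 := by
      unfold cosProd
      apply Finset.prod_eq_zero (i := 1) (by simp [hM1])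
      rw [h]; norm_num
    rw [this, zero_pow two_ne_zero]; positivity
  · have hθpos : 0 < θ := lt_trans (by positivity) hθ1
    have hs : Real.sin (2 * θ) ≠ 0 :=
      (Real.sin_pos_of_pos_of_lt_pi (by linarith) (by linarith)).ne'
    calc cosProd M θ ^ 2
        ≤ ((∑ j ∈ Finset.Icc 1 M, Real.cos ((2 * (j : ℝ) - 1) * θ) ^ 2) / M) ^ M :=
          cosProd_sq_le_mean_pow hM1 θ
      _ = (1 / 2 + Real.sin (4 * M * θ) / (4 * M * Real.sin (2 * θ))) ^ M := by
          rw [sum_cos_sq M hs]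
          congr 1
          field_simp
      _ ≤ (5 / 8 : ℝ) ^ M := by
          apply pow_le_pow_left₀ _ (mean_le hM hθ1 h)
          have := cosProd_sq_le_mean_pow hM1 θ
          rw [sum_cos_sq M hs] at this
          have e : ((M : ℝ) / 2 + Real.sin (4 * M * θ) / (4 * Real.sin (2 * θ))) / M =
              1 / 2 + Real.sin (4 * M * θ) / (4 * M * Real.sin (2 * θ)) := by
            field_simp
          -- nonnegativity of the mean: it is an average of squares
          have h0 : 0 ≤ (∑ j ∈ Finset.Icc 1 M, Real.cos ((2 * (j : ℝ) - 1) * θ) ^ 2) / M :=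
            div_nonneg (Finset.sum_nonneg fun _ _ => sq_nonneg _) hMpos.le
          rw [sum_cos_sq M hs, e] at h0
          exact h0

/-- The minor-arc integral is small: `‖∫_{π/(4M)}^{π/2} f‖ ≤ √((5/8)^M) · (π/2)`. [folklore] -/
private theorem norm_integral_minor_le {M ν : ℕ} (hM : 10 ≤ M) :
    ‖∫ θ in (π / (4 * M) : ℝ)..(π / 2), integrand M ν θ‖ ≤ Real.sqrt ((5 / 8 : ℝ) ^ M) * (π / 2) := by
  have hMr : (10 : ℝ) ≤ M := by exact_mod_cast hM
  have hMpos : (0 : ℝ) < M := by linarith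
  have ht0 : 0 ≤ π / (4 * M) := by positivity
  have htle : π / (4 * M) ≤ π / 2 :=
    div_le_div_of_nonneg_left Real.pi_pos.le (by norm_num) (by linarith)
  have hb := intervalIntegral.norm_integral_le_of_norm_le_const (a := π / (4 * M)) (b := π / 2)
    (f := integrand M ν) (C := Real.sqrt ((5 / 8 : ℝ) ^ M)) ?_
  · calc ‖∫ θ in (π / (4 * M) : ℝ)..(π / 2), integrand M ν θ‖
        ≤ Real.sqrt ((5 / 8 : ℝ) ^ M) * |π / 2 - π / (4 * M)| := hb
      _ ≤ Real.sqrt ((5 / 8 : ℝ) ^ M) * (π / 2) := by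
          apply mul_le_mul_of_nonneg_left _ (Real.sqrt_nonneg _)
          rw [abs_of_nonneg (by linarith)]
          linarith
  · intro θ hθ
    rw [Set.uIoc_of_le htle] at hθ
    have h1 : π / (4 * M) < θ := hθ.1
    have h2 : θ ≤ π / 2 := hθ.2
    have hP : |cosProd M θ| ≤ Real.sqrt ((5 / 8 : ℝ) ^ M) :=
      Real.abs_le_sqrt (cosProd_sq_le hM h1 h2)
    unfold integrand
    rw [Real.norm_eq_abs, abs_mul, abs_mul]
    calc |Real.sin θ| * |Real.sin ((ν : ℝ) * θ)| * |cosProd M θ|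
        ≤ 1 * 1 * Real.sqrt ((5 / 8 : ℝ) ^ M) := by
          apply mul_le_mul (mul_le_mul (Real.abs_sin_le_one _) (Real.abs_sin_le_one _)
            (abs_nonneg _) zero_le_one) hP (abs_nonneg _) (by norm_num)
      _ = Real.sqrt ((5 / 8 : ℝ) ^ M) := by ring

/-! #### The final numeric inequality -/

/-- `(5/8)^M · M^9 ≤ 1/150` for `M ≥ 100` (induction; base by `norm_num`). [folklore] -/
private theorem pow_mul_pow_le {M : ℕ} (hM : 100 ≤ M) : (5 / 8 : ℝ) ^ M * (M : ℝ) ^ 9 ≤ 1 / 150 := by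
  induction M, hM using Nat.le_induction with
  | base => norm_num
  | succ M hM ih =>
    have hMr : (100 : ℝ) ≤ M := by exact_mod_cast hM
    have hMpos : (0 : ℝ) < M := by linarith
    have hratio : ((M : ℝ) + 1) ^ 9 ≤ (8 / 5) * (M : ℝ) ^ 9 := by
      have h1 : (M : ℝ) + 1 ≤ (101 / 100) * M := by linarith
      have h2 : ((M : ℝ) + 1) ^ 9 ≤ ((101 / 100) * M) ^ 9 := pow_le_pow_left₀ (by positivity) h1 9
      have h3 : ((101 / 100 : ℝ) * M) ^ 9 = (101 / 100) ^ 9 * (M : ℝ) ^ 9 := mul_pow _ _ _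
      have h4 : (101 / 100 : ℝ) ^ 9 ≤ 8 / 5 := by norm_num
      nlinarith [pow_nonneg hMpos.le 9]
    push_cast
    calc (5 / 8 : ℝ) ^ (M + 1) * ((M : ℝ) + 1) ^ 9
        ≤ (5 / 8 : ℝ) ^ (M + 1) * ((8 / 5) * (M : ℝ) ^ 9) :=
          mul_le_mul_of_nonneg_left hratio (by positivity)
      _ = (5 / 8 : ℝ) ^ M * (M : ℝ) ^ 9 := by ring
      _ ≤ 1 / 150 := ih

/-! #### Assembly: the window lemma -/

/-- `0 < ∫_0^{π/2} f` for `M ≥ 100`, `1 ≤ ν ≤ 2M`: main term `(2/15)ν L^{-3/2}` on `[0, L^{-1/2}]`, nonnegative integrand up to `π/(4M)`, minor arc at most `(π/2)(5/8)^{M/2}`, and `(5/8)^M L³ ≤ (5/8)^M M⁹ ≤ 1/150 < (16/225)/π²`. [folklore] -/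
private theorem half_integral_pos {M ν : ℕ} (hM : 100 ≤ M) (hν1 : 1 ≤ ν) (hν2M : ν ≤ 2 * M) :
    0 < ∫ θ in (0 : ℝ)..(π / 2), integrand M ν θ := by
  have hM10 : 10 ≤ M := le_trans (by norm_num) hM
  have hM1 : 1 ≤ M := le_trans (by norm_num) hM
  have hMr : (100 : ℝ) ≤ M := by exact_mod_cast hM
  have hMpos : (0 : ℝ) < M := by linarith
  have hνr1 : (1 : ℝ) ≤ ν := by exact_mod_cast hν1
  have hνr2 : (ν : ℝ) ≤ 2 * M := by exact_mod_cast hν2M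
  have hπ3 : 3.14 < π := Real.pi_gt_d2
  have hπ4 : π < 3.15 := Real.pi_lt_d2
  -- numeric facts about M (small context)
  have hM3 : (M : ℝ) ≤ (M : ℝ) ^ 3 := by
    have h1 : (1 : ℝ) ≤ (M : ℝ) ^ 2 := by nlinarith only [hMr]
    calc (M : ℝ) = M * 1 := (mul_one _).symm
      _ ≤ M * (M : ℝ) ^ 2 := mul_le_mul_of_nonneg_left h1 hMpos.le
      _ = (M : ℝ) ^ 3 := by ring
  have hM3' : 4 * (M : ℝ) ^ 2 + 1 ≤ 2 * (M : ℝ) ^ 3 := by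
    nlinarith only [hMr, mul_nonneg (mul_nonneg hMpos.le hMpos.le) (sub_nonneg.mpr hMr)]
  have hν2 : (ν : ℝ) ^ 2 ≤ 4 * (M : ℝ) ^ 2 := by
    have := pow_le_pow_left₀ (Nat.cast_nonneg ν) hνr2 2
    linarith [this]
  have hν21 : (1 : ℝ) ≤ (ν : ℝ) ^ 2 := by nlinarith only [hνr1]
  -- parameters
  have hS : oddSqSum M = (4 * (M : ℝ) ^ 3 - M) / 3 := oddSqSum_eq M
  have hSpos : 0 < oddSqSum M := by rw [hS]; exact div_pos (by linarith) (by norm_num)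
  obtain ⟨L, hLdef⟩ : ∃ L : ℝ, L = 1 / 6 + (ν : ℝ) ^ 2 / 6 + oddSqSum M / 2 := ⟨_, rfl⟩
  have hLpos : 0 < L := by rw [hLdef]; positivity
  have hLle : L ≤ (M : ℝ) ^ 3 := by rw [hLdef, hS]; linarith
  have hL_ge : oddSqSum M / 2 ≤ L := by rw [hLdef]; nlinarith only [sq_nonneg (ν : ℝ)]
  obtain ⟨b, hbdef⟩ : ∃ b : ℝ, b = (Real.sqrt L)⁻¹ := ⟨_, rfl⟩
  have hsqrtL : 0 < Real.sqrt L := Real.sqrt_pos.mpr hLpos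
  have hb0 : 0 < b := by rw [hbdef]; exact inv_pos.mpr hsqrtL
  have hb2 : b ^ 2 * L = 1 := by
    rw [hbdef, inv_pow, Real.sq_sqrt hLpos.le, inv_mul_cancel₀ hLpos.ne']
  obtain ⟨t, htdef⟩ : ∃ t : ℝ, t = π / (4 * M) := ⟨_, rfl⟩
  have ht0 : 0 < t := by rw [htdef]; positivity
  have htle : t ≤ π / 2 := by
    rw [htdef]; exact div_le_div_of_nonneg_left Real.pi_pos.le (by norm_num) (by linarith)
  -- b ≤ t
  have hbt : b ≤ t := by
    have hb2' : b ^ 2 = 1 / L := by field_simp; linarith [hb2]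
    have ht2 : t ^ 2 = π ^ 2 / (16 * (M : ℝ) ^ 2) := by rw [htdef]; field_simp; ring
    have h16 : 16 * (M : ℝ) ^ 2 ≤ 9 * L := by
      have : 16 * (M : ℝ) ^ 2 ≤ 9 * (oddSqSum M / 2) := by rw [hS]; nlinarith only [hMr, hM3']
      linarith
    have hb2le : b ^ 2 ≤ t ^ 2 := by
      rw [hb2', ht2, div_le_div_iff₀ hLpos (by positivity)]
      have hπsq : 9 ≤ π ^ 2 := by nlinarith only [hπ3]
      nlinarith only [h16, mul_nonneg (sub_nonneg.mpr hπsq) hLpos.le]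
    exact (pow_le_pow_iff_left₀ hb0.le ht0.le two_ne_zero).mp hb2le
  -- the three pieces
  have hmain : 2 / 15 * (ν : ℝ) * b ^ 3 ≤ ∫ θ in (0 : ℝ)..b, integrand M ν θ :=
    integral_main_ge hLdef hb0 hb2
  have hmid : 0 ≤ ∫ θ in b..t, integrand M ν θ :=
    intervalIntegral.integral_nonneg hbt fun θ hθ =>
      integrand_nonneg hM1 hν2M (le_trans hb0.le hθ.1) (htdef ▸ hθ.2)
  have hminor' : -(Real.sqrt ((5 / 8 : ℝ) ^ M) * (π / 2)) ≤ ∫ θ in t..(π / 2), integrand M ν θ := by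
    have hminor := norm_integral_minor_le (M := M) (ν := ν) hM10
    rw [Real.norm_eq_abs, ← htdef] at hminor
    have := neg_abs_le (∫ θ in t..(π / 2), integrand M ν θ)
    linarith
  -- the numeric comparison: √((5/8)^M) π/2 < (2/15) ν b³
  have hkey : Real.sqrt ((5 / 8 : ℝ) ^ M) * (π / 2) < 2 / 15 * (ν : ℝ) * b ^ 3 := by
    have hπ2 : π ^ 2 < 9.93 := by nlinarith only [hπ4, Real.pi_pos]
    have hL3 : L ^ 3 ≤ (M : ℝ) ^ 9 := by
      calc L ^ 3 ≤ ((M : ℝ) ^ 3) ^ 3 := pow_le_pow_left₀ hLpos.le hLle 3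
        _ = (M : ℝ) ^ 9 := by ring
    have hL3pos : 0 < L ^ 3 := pow_pos hLpos 3
    have hb6 : b ^ 6 = 1 / L ^ 3 := by
      have e : b ^ 6 = (b ^ 2 * L) ^ 3 / L ^ 3 := by field_simp
      rw [e, hb2, one_pow]
    have lhs_sq : (Real.sqrt ((5 / 8 : ℝ) ^ M) * (π / 2)) ^ 2 = (5 / 8 : ℝ) ^ M * (π ^ 2 / 4) := by
      rw [mul_pow, Real.sq_sqrt (by positivity)]; ring
    have h58 : (5 / 8 : ℝ) ^ M * L ^ 3 ≤ 1 / 150 := by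
      calc (5 / 8 : ℝ) ^ M * L ^ 3 ≤ (5 / 8 : ℝ) ^ M * (M : ℝ) ^ 9 :=
            mul_le_mul_of_nonneg_left hL3 (by positivity)
        _ ≤ 1 / 150 := pow_mul_pow_le hM
    apply lt_of_pow_lt_pow_left₀ 2 (by positivity)
    rw [lhs_sq]
    have e : (2 / 15 * (ν : ℝ) * b ^ 3) ^ 2 = (4 / 225 * (ν : ℝ) ^ 2) / L ^ 3 := by
      rw [show (2 / 15 * (ν : ℝ) * b ^ 3) ^ 2 = 4 / 225 * (ν : ℝ) ^ 2 * b ^ 6 by ring, hb6]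
      ring
    rw [e, lt_div_iff₀ hL3pos]
    calc (5 / 8 : ℝ) ^ M * (π ^ 2 / 4) * L ^ 3
        = ((5 / 8 : ℝ) ^ M * L ^ 3) * (π ^ 2 / 4) := by ring
      _ ≤ (1 / 150) * (π ^ 2 / 4) := mul_le_mul_of_nonneg_right h58 (by positivity)
      _ < (1 / 150) * (9.93 / 4) := by nlinarith only [hπ2]
      _ ≤ 4 / 225 * (ν : ℝ) ^ 2 := by nlinarith only [hν21]
  -- combine
  have hsplit1 := intervalIntegral.integral_add_adjacent_intervals
    (intervalIntegrable_integrand M ν 0 b) (intervalIntegrable_integrand M ν b t)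
  have hsplit2 := intervalIntegral.integral_add_adjacent_intervals
    (intervalIntegrable_integrand M ν 0 t) (intervalIntegrable_integrand M ν t (π / 2))
  rw [← hsplit2, ← hsplit1]
  have hb3 : 0 < 2 / 15 * (ν : ℝ) * b ^ 3 := by positivity
  linarith

/-- **Window lemma** (the analytic input of the tree's proof of Pak–Panova 2014, Thm. 5.2 / Ikenmeyer–Panova 2017, Prop. 6.8, replacing Almkvist's theorem [A1] used in print for `n ≥ 2m+1`): for `M ≥ 100`, `2n + 2 ≤ M²` and `M² ≤ 2n + 1 + 2M` (i.e. `1 ≤ ν = M² - 2n - 1 ≤ 2M`, the coefficients just below the middle), `a_n(M) < a_{n+1}(M)`. Method: Odlyzko–Richmond's trigonometric integral for the difference, `π(a_{n+1} - a_n) = 2^{M+2} ∫_0^{π/2} sin θ sin(νθ) ∏_j cos((2j-1)θ) dθ > 0`. [cite: PakPanova2014Unimodality, Thm. 5.2 (proof; held arXiv:1304.5044 p. 8)] -/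
theorem window {M n : ℕ} (hM : 100 ≤ M) (hn : 2 * n + 2 ≤ M ^ 2) (hνle : M ^ 2 ≤ 2 * n + 1 + 2 * M) :
    oddPartsSubsetCount 1 M n < oddPartsSubsetCount 1 M (n + 1) := by
  obtain ⟨ν, hνdef⟩ : ∃ ν : ℕ, ν = M ^ 2 - 2 * n - 1 := ⟨_, rfl⟩
  have hν1 : 1 ≤ ν := by omega
  have hν2M : ν ≤ 2 * M := by omega
  have heven : Even (ν + M + 1) := by
    have e : ν + M + 1 = M ^ 2 + M - 2 * n := by omega
    rw [e, Nat.even_sub (by omega)]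
    constructor
    · intro _; exact even_two_mul n
    · intro _
      have : M ^ 2 + M = M * (M + 1) := by ring
      rw [this]; exact Nat.even_mul_succ_self M
  have hrep := pi_mul_sub_eq hn hνdef
  rw [integral_eq_two_mul heven] at hrep
  have hpos := half_integral_pos hM hν1 hν2M
  have h1 : 0 < π * ((oddPartsSubsetCount 1 M (n + 1) : ℝ) - oddPartsSubsetCount 1 M n) := by
    rw [hrep]; positivity
  have h2 : (0 : ℝ) < (oddPartsSubsetCount 1 M (n + 1) : ℝ) - oddPartsSubsetCount 1 M n := by
    by_contra hneg
    push Not at hneg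
    nlinarith only [Real.pi_pos, hneg, h1]
  exact_mod_cast (sub_pos.mp h2)

/-! ### §5 The induction on `M` -/

/-- Stability of the small coefficients: `a_j(m) = a_j(13)` for `j ≤ 26`, `m ≥ 13` (`= q(j)`, partitions of `j` into distinct odd parts; Pak–Panova: "for `n ≤ 2m` we have `a_n = q(n)`"). [cite: PakPanova2014Unimodality, Thm. 5.2 (proof; held arXiv:1304.5044 p. 8)] -/
private theorem small_stable {m j : ℕ} (hm : 13 ≤ m) (hj : j ≤ 26) :
    oddPartsSubsetCount 1 m j = oddPartsSubsetCount 1 13 j := by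
  induction m, hm using Nat.le_induction with
  | base => rfl
  | succ m hm ih =>
    rw [OddDistinctTable.oddPartsSubsetCount_one_succ_right, if_neg (by omega), add_zero, ih]

/-- The values `a_j(13) = q(j)`, `j ≤ 26`, read off the certified table (Pak–Panova Rem. 5.3: `q(25) = q(26) = 12`). [cite: PakPanova2014Unimodality, Rem. 5.3 (held arXiv:1304.5044 p. 8)] -/
private theorem a13_getD (i : ℕ) (hi : i < 27) :
    oddPartsSubsetCount 1 13 i =
      [1, 1, 0, 1, 1, 1, 1, 1, 2, 2, 2, 2, 3, 3, 3, 4, 5, 5, 5, 6, 7, 8, 8, 9, 11, 12, 12].getD i 0 := by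
  have V := OddDistinctTable.oddPartsSubsetCount_thirteen_values
  have h := congrArg (fun l : List ℕ => l.getD i 0) V
  simp only [List.getD_eq_getElem?_getD, List.getElem?_map, List.getElem?_range hi, Option.map_some,
    Option.getD_some] at h
  rw [h, List.getD_eq_getElem?_getD]

/-- The values `a_j(m) = q(j)`, `j ≤ 26`, at every level `m ≥ 13`. [cite: PakPanova2014Unimodality, Rem. 5.3 (held arXiv:1304.5044 p. 8)] -/
private theorem small_val {m : ℕ} (hm : 13 ≤ m) (i : ℕ) (hi : i < 27) :
    oddPartsSubsetCount 1 m i =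
      [1, 1, 0, 1, 1, 1, 1, 1, 2, 2, 2, 2, 3, 3, 3, 4, 5, 5, 5, 6, 7, 8, 8, 9, 11, 12, 12].getD i 0 := by
  rw [small_stable hm (by omega), a13_getD i hi]

/-- `q(j) ≤ q(j+1)` for `2 ≤ j ≤ 25` (Pak–Panova's injection `φ : 𝒬_n → 𝒬_{n+1}`; here read off the table). [cite: PakPanova2014Unimodality, Thm. 5.2 (proof; held arXiv:1304.5044 p. 8)] -/
private theorem small_mono {m i : ℕ} (hm : 13 ≤ m) (h2 : 2 ≤ i) (h25 : i ≤ 25) :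
    oddPartsSubsetCount 1 m i ≤ oddPartsSubsetCount 1 m (i + 1) := by
  rw [small_val hm i (by omega), small_val hm (i + 1) (by omega)]
  interval_cases i <;> decide

/-- The recurrence `a_s(ℓ+1) = a_s(ℓ) + a_{s-2ℓ-1}(ℓ)` with explicit indices. [folklore] -/
private theorem rec_explicit {ℓ ℓ' s k : ℕ} (hℓ : ℓ' = ℓ + 1) (hk : s = 2 * ℓ + 1 + k) :
    oddPartsSubsetCount 1 ℓ' s = oddPartsSubsetCount 1 ℓ s + oddPartsSubsetCount 1 ℓ k := by
  subst hℓ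
  rw [OddDistinctTable.oddPartsSubsetCount_one_succ_right, if_pos (by omega)]
  congr 2
  omega

/-- The special increment `a_{2m+2}(m) + 2 ≤ a_{2m+3}(m)` (`m = m₅ + 5 ≥ 18`), from the strict increase `a_{2m₅+12}(m₅) < a_{2m₅+13}(m₅)` five levels below: unrolling the recurrence five times adds the small values `q(4)+q(6)+q(8)+q(10)+q(12) = 9` to the upper coefficient and `q(3)+q(5)+q(7)+q(9)+q(11) = 7` to the lower one (Pak–Panova handle `a_{2m+1} > a_{2m}` separately for the same reason: the injection `φ` misses `q(2) = 0 < q(1)`). [cite: PakPanova2014Unimodality, Thm. 5.2 (proof; held arXiv:1304.5044 p. 8)] -/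
private theorem delta_special {m₅ : ℕ} (hm₅ : 13 ≤ m₅)
    (h : oddPartsSubsetCount 1 m₅ (2 * m₅ + 12) < oddPartsSubsetCount 1 m₅ (2 * m₅ + 13)) :
    oddPartsSubsetCount 1 (m₅ + 5) (2 * m₅ + 12) + 2 ≤
      oddPartsSubsetCount 1 (m₅ + 5) (2 * m₅ + 13) := by
  have t5 := rec_explicit (ℓ := m₅ + 4) (ℓ' := m₅ + 5) (s := 2 * m₅ + 13) (k := 4) (by omega) (by omega)
  have t4 := rec_explicit (ℓ := m₅ + 3) (ℓ' := m₅ + 4) (s := 2 * m₅ + 13) (k := 6) (by omega) (by omega)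
  have t3 := rec_explicit (ℓ := m₅ + 2) (ℓ' := m₅ + 3) (s := 2 * m₅ + 13) (k := 8) (by omega) (by omega)
  have t2 := rec_explicit (ℓ := m₅ + 1) (ℓ' := m₅ + 2) (s := 2 * m₅ + 13) (k := 10) (by omega) (by omega)
  have t1 := rec_explicit (ℓ := m₅) (ℓ' := m₅ + 1) (s := 2 * m₅ + 13) (k := 12) (by omega) (by omega)
  have u5 := rec_explicit (ℓ := m₅ + 4) (ℓ' := m₅ + 5) (s := 2 * m₅ + 12) (k := 3) (by omega) (by omega)
  have u4 := rec_explicit (ℓ := m₅ + 3) (ℓ' := m₅ + 4) (s := 2 * m₅ + 12) (k := 5) (by omega) (by omega)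
  have u3 := rec_explicit (ℓ := m₅ + 2) (ℓ' := m₅ + 3) (s := 2 * m₅ + 12) (k := 7) (by omega) (by omega)
  have u2 := rec_explicit (ℓ := m₅ + 1) (ℓ' := m₅ + 2) (s := 2 * m₅ + 12) (k := 9) (by omega) (by omega)
  have u1 := rec_explicit (ℓ := m₅) (ℓ' := m₅ + 1) (s := 2 * m₅ + 12) (k := 11) (by omega) (by omega)
  have w4 : oddPartsSubsetCount 1 (m₅ + 4) 4 = 1 := by rw [small_val (by omega) 4 (by norm_num)]; rfl
  have w6 : oddPartsSubsetCount 1 (m₅ + 3) 6 = 1 := by rw [small_val (by omega) 6 (by norm_num)]; rfl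
  have w8 : oddPartsSubsetCount 1 (m₅ + 2) 8 = 2 := by rw [small_val (by omega) 8 (by norm_num)]; rfl
  have w10 : oddPartsSubsetCount 1 (m₅ + 1) 10 = 2 := by rw [small_val (by omega) 10 (by norm_num)]; rfl
  have w12 : oddPartsSubsetCount 1 m₅ 12 = 3 := by rw [small_val (by omega) 12 (by norm_num)]; rfl
  have w3 : oddPartsSubsetCount 1 (m₅ + 4) 3 = 1 := by rw [small_val (by omega) 3 (by norm_num)]; rfl
  have w5 : oddPartsSubsetCount 1 (m₅ + 3) 5 = 1 := by rw [small_val (by omega) 5 (by norm_num)]; rfl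
  have w7 : oddPartsSubsetCount 1 (m₅ + 2) 7 = 1 := by rw [small_val (by omega) 7 (by norm_num)]; rfl
  have w9 : oddPartsSubsetCount 1 (m₅ + 1) 9 = 2 := by rw [small_val (by omega) 9 (by norm_num)]; rfl
  have w11 : oddPartsSubsetCount 1 m₅ 11 = 2 := by rw [small_val (by omega) 11 (by norm_num)]; rfl
  omega

/-- The strict-increase property at level `M`: `a_n(M) < a_{n+1}(M)` for `26 ≤ n`, `2n + 2 ≤ M²`. [folklore] -/
private def StrictIncr (M : ℕ) : Prop :=
  ∀ n : ℕ, 26 ≤ n → 2 * n + 2 ≤ M ^ 2 → oddPartsSubsetCount 1 M n < oddPartsSubsetCount 1 M (n + 1)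

/-- **The induction step `m → m+1`, `m ≥ 120`**: below the old middle (`2n + 2 ≤ m²`) the recurrence `a_s(m+1) = a_s(m) + a_{s-2m-1}(m)` and the induction hypothesis (plus `small_mono` / `delta_special` for the shifted term) give the strict increase; in the window `m² < 2n + 2 ≤ (m+1)²` it is the analytic `window` lemma. [cite: PakPanova2014Unimodality, Thm. 5.2 (proof; held arXiv:1304.5044 p. 8)] -/
private theorem strictIncr_step {m : ℕ} (hm : 120 ≤ m) (IH : ∀ m', 27 ≤ m' → m' ≤ m → StrictIncr m') :
    StrictIncr (m + 1) := by
  intro n h26 hn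
  by_cases hw : m ^ 2 < 2 * n + 2
  · -- the window: analytic lemma
    exact window (by omega) hn (by nlinarith)
  · push Not at hw
    have R := OddDistinctTable.oddPartsSubsetCount_one_succ_right
    have hIH : oddPartsSubsetCount 1 m n < oddPartsSubsetCount 1 m (n + 1) := IH m (by omega) le_rfl n h26 hw
    rw [R m (n + 1), R m n]
    by_cases h1 : 2 * m + 1 ≤ n
    · rw [if_pos (show 2 * m + 1 ≤ n + 1 by omega), if_pos h1]
      obtain ⟨i, rfl⟩ : ∃ i, n = 2 * m + 1 + i := ⟨n - (2 * m + 1), by omega⟩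
      rw [show 2 * m + 1 + i + 1 - (2 * m + 1) = i + 1 by omega,
        show 2 * m + 1 + i - (2 * m + 1) = i by omega]
      -- second term: a_m(i) ≤ a_m(i+1) unless i = 1
      rcases Nat.lt_or_ge i 2 with hi | hi
      · interval_cases i
        · -- i = 0: a_m(0) = 1 ≤ a_m(1) = 1
          have v0 := small_val (m := m) (by omega) 0 (by norm_num)
          have v1 := small_val (m := m) (by omega) (0 + 1) (by norm_num)
          simp only [List.getD_cons_succ, List.getD_cons_zero] at v0 v1
          omega
        · -- i = 1: n = 2m + 2, the special increment
          have v1 := small_val (m := m) (by omega) 1 (by norm_num)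
          have v2 := small_val (m := m) (by omega) (1 + 1) (by norm_num)
          simp only [List.getD_cons_succ, List.getD_cons_zero] at v1 v2
          obtain ⟨m₅, rfl⟩ : ∃ m₅, m = m₅ + 5 := ⟨m - 5, by omega⟩
          have h5 := IH m₅ (by omega) (by omega) (2 * m₅ + 12) (by omega) (by nlinarith)
          have hsp := delta_special (by omega) h5
          have e2 : 2 * (m₅ + 5) + 1 + 1 = 2 * m₅ + 12 := by ring
          have e3 : 2 * m₅ + 12 + 1 = 2 * m₅ + 13 := by ring
          rw [e2] at hIH ⊢
          rw [e3] at hIH ⊢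
          omega
      · rcases Nat.lt_or_ge i 26 with hi' | hi'
        · have := small_mono (m := m) (by omega) hi (by omega)
          omega
        · have := IH m (by omega) le_rfl i hi' (by nlinarith)
          omega
    · rw [if_neg h1]
      by_cases h0 : 2 * m + 1 ≤ n + 1
      · -- n = 2m: second term a_m(0) = 1
        rw [if_pos h0]
        omega
      · rw [if_neg h0]
        omega

/-- Strict increase for all `M ≥ 27`: base `27 ≤ M ≤ 120` by the kernel certificate `OddDistinctTable.oddPartsSubsetCount_strictIncr_base`, then `strictIncr_step`. [cite: PakPanova2014Unimodality, Thm. 5.2 (proof; held arXiv:1304.5044 p. 8)] -/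
private theorem strictIncr_all (M : ℕ) (hM : 27 ≤ M) : StrictIncr M := by
  suffices H : ∀ K : ℕ, ∀ M, 27 ≤ M → M ≤ K → StrictIncr M from H M M hM le_rfl
  intro K
  induction K with
  | zero => intro M h1 h2; omega
  | succ K ih =>
    intro M h27 hMK
    by_cases hle : M ≤ K
    · exact ih M h27 hle
    · have hMK' : M = K + 1 := by omega
      subst hMK'
      by_cases h120 : K + 1 ≤ 120
      · intro n h26 hn
        exact OddDistinctTable.oddPartsSubsetCount_strictIncr_base h27 h120 h26 hn
      · exact strictIncr_step (by omega) fun m' h1 h2 => ih m' h1 h2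


/-- **Pak–Panova 2014, Thm. 5.2 (increasing half) = Ikenmeyer–Panova 2017, Prop. 6.8 (clause
`b_{i-1} < b_i`) — PROVED**: for every `M ≥ 27`, `26 ≤ n` and `2n + 2 ≤ M²` (i.e. `n < (M²-1)/2`),
`a_n(M) < a_{n+1}(M)`, where `a_n(M) = oddPartsSubsetCount 1 M n` is the number of partitions of `n` into
distinct odd parts `≤ 2M - 1` (the coefficient of `q^n` in `∏_{i=1}^M (1 + q^{2i-1})`). Printed proof:
injection for `26 ≤ n ≤ 2M` and Almkvist's analytic theorem [A1] for `n ≥ 2M + 1`; the tree's proof: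
kernel certificate for `M ≤ 120`, then induction on `M` with the analytic `window` lemma.
[cite: PakPanova2014Unimodality, Thm. 5.2 (held arXiv:1304.5044 p. 8); IkenmeyerPanova2017, Prop. 6.8 (TeX L1430–1437)] -/
theorem oddPartsSubsetCount_one_strictIncr {M n : ℕ} (hM : 27 ≤ M) (h26 : 26 ≤ n)
    (hn : 2 * n + 2 ≤ M ^ 2) : oddPartsSubsetCount 1 M n < oddPartsSubsetCount 1 M (n + 1) :=
  strictIncr_all M hM n h26 hn

end OddDistinctUnimodal

/-! ### §6 Ikenmeyer–Panova 2017, Prop. 6.8 -/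

open OddDistinctUnimodal in
/-- **Ikenmeyer–Panova 2017, Prop. 6.8 (= Pak–Panova 2014, Thm. 5.2, "extending a result of
Almkvist") — DISCHARGED**: `theorem ikenmeyerPanova2017_prop_6_8_holds : ikenmeyerPanova2017_prop_6_8`.
For `d ≥ 27` the numbers `b_j = oddPartsSubsetCount 1 d j` of partitions of `j` into distinct odd parts
`≤ 2d - 1` (coefficients of `∏_{i=1}^d (1 + q^{2i-1})`) satisfy: `b_j = b_{d²-j}` (`j ≤ d²`);
`b_{i-1} < b_i` for `27 ≤ i`, `2i ≤ d²`; `b_{i+1} < b_i` for `d² < 2i`, `i + 27 ≤ d²` — exactly the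
tree's statement (`IP17KroneckerPositivity`). Symmetry by complementation; the increasing half is
`oddPartsSubsetCount_one_strictIncr`; the decreasing half is its mirror image under the symmetry.
[cite: IkenmeyerPanova2017, Prop. 6.8 (TeX L1430–1437; held: Proposition 32, chunk p0016); PakPanova2014Unimodality, Thm. 5.2 (held arXiv:1304.5044 p. 8)] -/
theorem ikenmeyerPanova2017_prop_6_8_holds : ikenmeyerPanova2017_prop_6_8 := by
  intro d hd
  have P := strictIncr_all d (by omega)
  refine ⟨fun j hj => oddPartsSubsetCount_one_symm hj, fun i hi h2i => ?_, fun i hi h27 => ?_⟩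
  · have := P (i - 1) (by omega) (by omega)
    rwa [show i - 1 + 1 = i by omega] at this
  · have hi1 : i + 1 ≤ d ^ 2 := by omega
    have hi0 : i ≤ d ^ 2 := by omega
    rw [oddPartsSubsetCount_one_symm hi1, oddPartsSubsetCount_one_symm hi0]
    have := P (d ^ 2 - (i + 1)) (by omega) (by omega)
    rwa [show d ^ 2 - (i + 1) + 1 = d ^ 2 - i by omega] at this

/-! ### §7 Ikenmeyer–Panova 2017, Thm. 6.1, monotonicity clause — unconditional -/

open Literature.NumberTheory.DiophantineGeometry (kroneckerCoeff) in
/-- **Ikenmeyer–Panova 2017, Thm. 6.1, monotonicity clause (in the form its printed proof establishes: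
`d ≥ 27`, `26 < k ≤ d²/2`) — now UNCONDITIONAL**: for `n ≥ d ≥ 27` and `26 < k ≤ d²/2`,
`g((nd-k+2, 1^{k-2}), d × n, d × n) < g((nd-k, 1^k), d × n, d × n)`. The tree's
`ikenmeyerPanova2017_thm_6_1_mono` (t05 g0) took Prop. 6.4 and Prop. 6.8 as hypotheses; t02 g4's
`IkenmeyerPanova2017.thm_6_1_mono_of_prop_6_8` supplied Prop. 6.4 (`ikenmeyerPanova2017_prop_6_4_holds`);
this supplies Prop. 6.8 (`ikenmeyerPanova2017_prop_6_8_holds`). (The clause AS PRINTED, "for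
`k ≤ d²/2`" without `d ≥ 27`, `k > 26`, is false — see the ERRATUM note at
`ikenmeyerPanova2017_thm_6_1_mono`.)
[cite: IkenmeyerPanova2017, Thm. 6.1 (monotonicity clause) with its proof (TeX L1355, L1438–1447; held: Theorem 28 and its proof, chunks p0014, p0016)] -/
theorem IkenmeyerPanova2017.thm_6_1_mono {d n k : ℕ} (hd : 27 ≤ d) (hdn : d ≤ n) (hk : 26 < k)
    (hk' : 2 * k ≤ d ^ 2) (lam lam'' : Nat.Partition (d * n))
    (hlam : lam.parts = (d * n - k) ::ₘ Multiset.replicate k 1)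
    (hlam'' : lam''.parts = (d * n - (k - 2)) ::ₘ Multiset.replicate (k - 2) 1) :
    kroneckerCoeff ℂ lam'' (Nat.Partition.rectangle d n) (Nat.Partition.rectangle d n) <
      kroneckerCoeff ℂ lam (Nat.Partition.rectangle d n) (Nat.Partition.rectangle d n) :=
  IkenmeyerPanova2017.thm_6_1_mono_of_prop_6_8 ikenmeyerPanova2017_prop_6_8_holds hd hdn hk hk' lam
    lam'' hlam hlam''

end Literature.Computability.AlgebraicComplexity
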